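import Summits.ResolutionOfSingularities.ResolutionOfSingularities.Theorems.FrobeniusClosingPatchingRelPerfectDepthParamLiftPolynomialLoc
import Mathlib.Algebra.MvPolynomial.Equiv
import HarnessLib

/-!
# Crux `PatchingRelPerfect` (stmt-ResolutionOfSingularities-16161), chain W5.2 — F7(β) d = 2 (β-AX), X2a module 2 (M2c), e-chart algebra III:
# PARAM-LIFT data between two localised polynomial charts differing by ONE variable

[OURS · L1 W5.2 · F7(β) (β-AX) X-side · res-D-pv-034 AS res-L1-s36-pv-3 per res-L1-w52-plan-1 RULING G11-21 ((M2c) PARAM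
PROPAGATION, e-chart half; blueprint `D/res-D-pv-034/M2C-ECHART-BLUEPRINT.md` steps E2b(ii)/E3).]  Replaces the role of NO printed
item; NOT a statement of the manuscript under review; fact-free, def-free.  AI-written; AI review is weaker than expert review.

The two e-chart stalks modulo the matched exceptional parameter are localisations `SA = Λ[T_m : m ≠ l]_{𝔓A}`,
`SX = Λ′[T_m : m ≠ l+1]_{𝔓X}` (`…ParamLiftChartQuotient`), the coefficient rings being identified by the SECTION ISO `κ : Λ ≅ Λ′`
(`…ParamLiftSection`), and the induced local map `f : SA → SX` sends `C r ↦ C (κ r)`, `T_m ↦ T_{m+1}`.  Re-indexing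
`{m : Fin (c+1) // m ≠ l+1} ≃ Option {m : Fin c // m ≠ l}` (`none ↦ 0`) makes `Λ′[T_m : m ≠ l+1] ≅ (Λ[T_m : m ≠ l])[X]` with `f`
compatible with `C`, so ALGEBRA II′ (`…ParamLiftPolynomialLoc`) applies: PARAM-LIFT data for `f`.

* `finSuccNeEquiv` bookkeeping (as an explicit `Equiv`), `polyChartEquiv` facts (as existence statements, no defs),
* **`exists_finset_sup_span_eq_maximalIdeal_of_polynomialCharts`**.

## References
* H. Matsumura, *Commutative Ring Theory* (1986), Thm. 23.7. [Matsumura1987]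
-/

-- `Summit.<Summit>.<Sub>.Theorems` with `Sub = Summit` (single-conjunct summit, D-0017)
set_option linter.dupNamespace false

noncomputable section

open IsLocalRing Polynomial
open Literature.AlgebraicGeometry.Resolution

namespace Summit.ResolutionOfSingularities.ResolutionOfSingularities.Theorems.DepthMultiHost

universe u

/-- **The chart isomorphism `(Λ[T_m : m ≠ l])[X] ≅ Λ′[T_m : m ≠ l+1]`** along `κ : Λ ≅ Λ′`, `X ↦ T_0`, `T_m ↦ T_{m+1}` (existence
with its values on generators). [folklore] -/
theorem exists_polynomialChartEquiv {Λ Λ' : Type u} [CommRing Λ] [CommRing Λ'] (κ : Λ ≃+* Λ') {c : ℕ} (l : Fin c) :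
    ∃ Φ : (MvPolynomial {m : Fin c // m ≠ l} Λ)[X] ≃+* MvPolynomial {m : Fin (c + 1) // m ≠ l.succ} Λ',
      (∀ r, Φ (Polynomial.C (MvPolynomial.C r)) = MvPolynomial.C (κ r)) ∧
      (∀ m : {m : Fin c // m ≠ l}, Φ (Polynomial.C (MvPolynomial.X m)) =
        MvPolynomial.X ⟨m.1.succ, fun h => m.2 (Fin.succ_injective _ h)⟩) ∧
      Φ Polynomial.X = MvPolynomial.X ⟨0, (Fin.succ_ne_zero l).symm⟩ := by
  classical
  -- the index equivalence `Option {m // m ≠ l} ≃ {m // m ≠ l.succ}`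
  let e : Option {m : Fin c // m ≠ l} ≃ {m : Fin (c + 1) // m ≠ l.succ} :=
    { toFun := fun o => o.elim ⟨0, (Fin.succ_ne_zero l).symm⟩ fun m => ⟨m.1.succ, fun h => m.2 (Fin.succ_injective _ h)⟩
      invFun := fun m => if h : m.1 = 0 then none else
        some ⟨m.1.pred h, fun h' => m.2 (by rw [← Fin.succ_pred m.1 h, h'])⟩
      left_inv := by
        rintro (_ | m)
        · simp
        · simp only [Option.elim_some, Fin.succ_ne_zero, ↓reduceDIte, Fin.pred_succ]
      right_inv := by
        rintro ⟨m, hm⟩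
        by_cases h : m = 0
        · subst h; simp
        · simp [h] }
  let Φ : (MvPolynomial {m : Fin c // m ≠ l} Λ)[X] ≃+* MvPolynomial {m : Fin (c + 1) // m ≠ l.succ} Λ' :=
    (MvPolynomial.optionEquivLeft Λ {m : Fin c // m ≠ l}).symm.toRingEquiv.trans
      (((MvPolynomial.renameEquiv Λ e).toRingEquiv).trans (MvPolynomial.mapEquiv _ κ))
  refine ⟨Φ, fun r => ?_, fun m => ?_, ?_⟩
  · have h1 : (MvPolynomial.optionEquivLeft Λ {m : Fin c // m ≠ l}).symm (Polynomial.C (MvPolynomial.C r)) = MvPolynomial.C r := by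
      rw [AlgEquiv.symm_apply_eq, MvPolynomial.optionEquivLeft_C]
    simp [Φ, h1]
  · have h1 : (MvPolynomial.optionEquivLeft Λ {m : Fin c // m ≠ l}).symm (Polynomial.C (MvPolynomial.X m)) =
        MvPolynomial.X (some m) := by
      rw [AlgEquiv.symm_apply_eq, MvPolynomial.optionEquivLeft_X_some]
    simp [Φ, h1, e]
  · have h1 : (MvPolynomial.optionEquivLeft Λ {m : Fin c // m ≠ l}).symm Polynomial.X = MvPolynomial.X none := by
      rw [AlgEquiv.symm_apply_eq, MvPolynomial.optionEquivLeft_X_none]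
    simp [Φ, h1, e]

/-- In a local ring map setting: the preimage of the maximal ideal under a local homomorphism is the maximal ideal. [folklore] -/
theorem comap_maximalIdeal_of_isLocalHom {S T : Type u} [CommRing S] [CommRing T] [IsLocalRing S] [IsLocalRing T] (f : S →+* T)
    [IsLocalHom f] : (maximalIdeal T).comap f = maximalIdeal S := by
  refine le_antisymm (IsLocalRing.le_maximalIdeal (Ideal.IsPrime.ne_top inferInstance)) fun x hx => ?_
  rw [Ideal.mem_comap]
  exact map_nonunit f x hx

/-- [OURS · L1 W5.2 · F7(β) (β-AX) M2c, ALGEBRA III] **PARAM-LIFT data between two localised polynomial charts differing by one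
variable**: `SA = Λ[T̂_l]_{𝔓A}` regular, `SX = Λ′[T̂_{l+1}]_{𝔓X}`, `κ : Λ ≅ Λ′`, `f : SA → SX` local with `f (C r) = C (κ r)`,
`f (T_m) = T_{m+1}`; then `∃ s, 𝔪_{SA}·SX ⊔ (s) = 𝔪_{SX}` with `#s + emb dim SA = emb dim SX`. [cite: Matsumura1987, Thm. 23.7] -/
theorem exists_finset_sup_span_eq_maximalIdeal_of_polynomialCharts {Λ Λ' : Type u} [CommRing Λ] [CommRing Λ'] (κ : Λ ≃+* Λ')
    {c : ℕ} (l : Fin c) {SA : Type u} [CommRing SA] [IsRegularLocalRing SA]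
    (𝔓A : Ideal (MvPolynomial {m : Fin c // m ≠ l} Λ)) [𝔓A.IsPrime]
    (algA : MvPolynomial {m : Fin c // m ≠ l} Λ →+* SA) (hlocA : @IsLocalization.AtPrime _ _ SA _ algA.toAlgebra 𝔓A _)
    {SX : Type u} [CommRing SX] [IsLocalRing SX]
    (𝔓X : Ideal (MvPolynomial {m : Fin (c + 1) // m ≠ l.succ} Λ')) [𝔓X.IsPrime]
    (algX : MvPolynomial {m : Fin (c + 1) // m ≠ l.succ} Λ' →+* SX)
    (hlocX : @IsLocalization.AtPrime _ _ SX _ algX.toAlgebra 𝔓X _)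
    (f : SA →+* SX) [IsLocalHom f] (hC : ∀ r, f (algA (MvPolynomial.C r)) = algX (MvPolynomial.C (κ r)))
    (hX : ∀ m : {m : Fin c // m ≠ l}, f (algA (MvPolynomial.X m)) =
      algX (MvPolynomial.X ⟨m.1.succ, fun h => m.2 (Fin.succ_injective _ h)⟩)) :
    ∃ s : Finset SX, (maximalIdeal SA).map f ⊔ Ideal.span (s : Set SX) = maximalIdeal SX ∧
      s.card + (maximalIdeal SA).spanFinrank = (maximalIdeal SX).spanFinrank := by
  classical
  obtain ⟨Φ, hΦC, hΦX, -⟩ := exists_polynomialChartEquiv κ l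
  -- `SX` as a localisation of `(Λ[T̂_l])[X]` along `Φ`
  letI algAi : Algebra (MvPolynomial {m : Fin c // m ≠ l} Λ) SA := algA.toAlgebra
  letI algXi : Algebra (MvPolynomial {m : Fin (c + 1) // m ≠ l.succ} Λ') SX := algX.toAlgebra
  haveI := hlocA
  haveI := hlocX
  have hbase := IsLocalization.isLocalization_of_base_ringEquiv 𝔓X.primeCompl SX Φ.symm
  letI algPi : Algebra (MvPolynomial {m : Fin c // m ≠ l} Λ)[X] SX := ((algebraMap _ SX).comp Φ.symm.symm.toRingHom).toAlgebra
  set 𝔔 : Ideal (MvPolynomial {m : Fin c // m ≠ l} Λ)[X] := 𝔓X.comap Φ.toRingHom with h𝔔def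
  haveI : 𝔔.IsPrime := Ideal.comap_isPrime _ _
  have hsub : 𝔓X.primeCompl.map Φ.symm = 𝔔.primeCompl := by
    ext q
    simp only [Submonoid.mem_map, Ideal.mem_primeCompl_iff, h𝔔def, Ideal.mem_comap]
    constructor
    · rintro ⟨p, hp, rfl⟩
      simpa using hp
    · intro hq
      exact ⟨Φ q, hq, by simp⟩
  haveI hlocQ : @IsLocalization.AtPrime _ _ SX _ algPi 𝔔 _ := by
    have h := hbase
    rw [hsub] at h
    exact h
  -- compatibility of `f` with `C`
  have hf : f.comp (algebraMap _ SA) = (algebraMap (MvPolynomial {m : Fin c // m ≠ l} Λ)[X] SX).comp C := by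
    refine MvPolynomial.ringHom_ext (fun r => ?_) (fun m => ?_)
    · show f (algA (MvPolynomial.C r)) = algX (Φ.symm.symm (Polynomial.C (MvPolynomial.C r)))
      rw [hC, RingEquiv.symm_symm, hΦC]
    · show f (algA (MvPolynomial.X m)) = algX (Φ.symm.symm (Polynomial.C (MvPolynomial.X m)))
      rw [hX, RingEquiv.symm_symm, hΦX]
  -- `𝔔 ∩ Λ[T̂_l] = 𝔓A`
  have h𝔔 : 𝔔.comap C = 𝔓A := by
    have hA : 𝔓A = (maximalIdeal SA).comap algA := (IsLocalization.AtPrime.under_maximalIdeal SA 𝔓A).symm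
    have hXm : 𝔓X = (maximalIdeal SX).comap algX := (IsLocalization.AtPrime.under_maximalIdeal SX 𝔓X).symm
    rw [hA, h𝔔def, hXm, Ideal.comap_comap, Ideal.comap_comap, ← comap_maximalIdeal_of_isLocalHom f, Ideal.comap_comap]
    congr 1
    refine MvPolynomial.ringHom_ext (fun r => ?_) (fun m => ?_)
    · show algX (Φ (Polynomial.C (MvPolynomial.C r))) = f (algA (MvPolynomial.C r))
      rw [hC, hΦC]
    · show algX (Φ (Polynomial.C (MvPolynomial.X m))) = f (algA (MvPolynomial.X m))
      rw [hX, hΦX]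
  exact exists_finset_sup_span_eq_maximalIdeal_polynomial_isLocalization 𝔓A 𝔔 h𝔔 f hf

end Summit.ResolutionOfSingularities.ResolutionOfSingularities.Theorems.DepthMultiHost

end
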